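/-
Copyright (c) 2026 the pub-hodgecm-mathlib formalisation cell (harness21).  Prover seat hodgecm-mathlib-LH4-p05 (g0): Track A «(D-RAM) FOUR-FRAME» squad of crux H413
(dealer LH4-plan (g10) WORD #29 ∕ heir LEAD F0P3a-plan (g19) T18-07 (3): «(f) `stub_U2H_leviRow_wild` → p05», HOME census v2 §C∕§E, brick L6), 2026-09-03.
The hypothesis-form twin of ★ `UnitOrbitalIntegralSplitTorusNonsplit` (C2): the Jacobowitz input `H′_w ≅ Φ₃` integrally is a BINDER, so the unramified-place hypothesis disappears;
the proofs are ★ C2's VERBATIM.  Plus the corollary for the quasi-split form `H′ = Φ₃` at EVERY non-split place (`T = 1`).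
-/
import Literature.NumberTheory.Automorphic.UnitOrbitalIntegralSplitTorusNonsplit     -- ★ C2 (shape of record; its whole import closure: descent, twist, canonical measures, regular diagonal centraliser)
import Literature.NumberTheory.Automorphic.UnitaryGroupFormCongrFinSum               -- ★ `formCongr_one_eq` (congruence by the identity frame)
import HarnessLib

/-!
# The unit orbital integral at a SPLIT-TORUS class, non-split place, WITHOUT the unramified hypothesis:
# `Φ(⟦γ₀⟧, 1_{K′}) = (‖d₀⁻¹d₁ − 1‖ · χ⁻(d₀⁻¹d₂ − 1))⁻¹` whenever `H′_w` is integrally congruent to `Φ₃` — in particular for `H′ = Φ₃` at every place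
(Rogawski 1990 §4.9 Prop. 4.9.1 (b), (4.9.2); §4.3 (4.3.1); Deitmar–Echterhoff Thm. 1.5.3)

Topic `NumberTheory/Automorphic`; namespace `Literature.NumberTheory.Automorphic.UnitaryGroup` (as ★ C2).  THEOREMS ONLY (no definition, no instance, no notation, no named fact,
no `sorry`).  Cell `pub/hodgecm-mathlib`, crux H413 = `stmt-HodgeConjecture-24833` (count-neutral), Track A «(D-RAM) FOUR-FRAME», unit U2H child (f) `stub_U2H_leviRow_wild`
(LH4-p05 (g0) census v2 8155187a2585211d §C: the G-SIDE LEVI VALUE of the anchor piece `1_{K₀}`, `K₀ = U(Φ₃)(𝒪_v)`, at a WILD ramified place).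

THE MATHEMATICS = ★ `UnitOrbitalIntegralSplitTorusNonsplit` VERBATIM.  There, `hv : v unramified` (with `H′_w ∈ GL₃(𝒪_w)`) is used at exactly ONE point: to produce `T ∈ GL₃(𝒪_w)` with
`H′_w = ᵗσ_w T · Φ₃ · T` (Jacobowitz, ★ `exists_glInt_placeForm_eq_formCongr_antidiagonal_of_isUnramifiedIn`), whence the level-preserving comparison `ψ = localNonsplitCongr T`.
Taking that congruence as the BINDER `hJT` removes every ramification hypothesis: §1 `exists_continuousMulEquiv_level_isConj_of_formCongr`, §2
`exists_classOrbitalIntegral_indicator_eq_twist_of_torus_regular_of_formCongr` (statement = ★ C2's with `(hv) (hH'w) (hH'i)` ↦ `(hJT)`; proof verbatim).  §3: for the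
quasi-split form `H′ = Φ₃` the binder is discharged by `T = 1` (★ `formCongr_one_eq`, ★ `placeForm_antidiagOne`) at EVERY non-split place, tame or wild:
**`exists_classOrbitalIntegral_indicator_eq_twist_of_torus_regular_antidiagOne`** — the Levi∕split-torus value of the unit `1_{K₀}` of the quasi-split `U(2,1)` that the
FOUR-FRAME line's anchor row (iv-0)∕(f) consumes at a dyadic ramified place.

HONEST LABEL: HC_CM is proved only modulo the 7 printed citations (2 remaining named inputs: hLiu418 = `stmt-HodgeConjecture-24832`, h413 = `stmt-HodgeConjecture-24833`) until
rung 0 closes; this file is unconditional, asserts nothing printed and freezes no stub text.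

## References
* [Rogawski1990] J. D. Rogawski, *Automorphic Representations of Unitary Groups in Three Variables*, Ann. of Math. Stud. 123 (1990), §4.9 Prop. 4.9.1 (b), (4.9.2) p. 55;
  §4.3 (4.3.1) p. 43; §14.2 p. 233.
* [DeitmarEchterhoff2014] A. Deitmar, S. Echterhoff, *Principles of Harmonic Analysis*, 2nd ed. (2014), Thm. 1.5.3.
* [Jacobowitz1962] R. Jacobowitz, *Hermitian forms over local fields*, Amer. J. Math. 84 (1962), §7 Thm. 7.1.
-/

set_option autoImplicit false

noncomputable section

open MeasureTheory Measure Set Filter Topology NumberField IsDedekindDomain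
open Literature.MeasureTheory.Group
open scoped ENNReal NNReal Matrix MatrixGroups

namespace Literature.NumberTheory.Automorphic.UnitaryGroup

open Literature.NumberTheory.Rogawski1990 (IsRegularElt isRegularElt_iff isRegularElt_of_isConj)
open Literature.NumberTheory.Automorphic

/-! ## §1 The comparison `ψ` from an integral congruence `H′_w = ᵗσT·Φ₃·T` -/

/-- `IsConj` descends along a multiplicative equivalence. [cite: Rogawski1990, §3.1 p. 19] -/
private theorem isConj_of_isConj_mulEquiv' {G G' : Type*} [Monoid G] [Monoid G'] (e : G ≃* G') {a b : G}
    (h : IsConj (e a) (e b)) : IsConj a b := by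
  have h' := MonoidHom.map_isConj e.symm.toMonoidHom h
  simpa using h'

/-- **THE LEVEL-PRESERVING COMPARISON `ψ : U(H′)(L⁺_v) ≃ U(Φ₃)(L⁺_v)` at ANY non-split place where `H′_w` is INTEGRALLY CONGRUENT to `Φ₃`, WITH its conjugacy datum** —
the hypothesis-form twin of ★ `exists_continuousMulEquiv_level_isConj_of_nonsplit` (there the congruence `H′_w = ᵗσT·Φ₃·T`, `T ∈ GL₃(𝒪_w)`, comes from Jacobowitz at a good
unramified place, ★ `exists_glInt_placeForm_eq_formCongr_antidiagonal_of_isUnramifiedIn`; here it is the binder `hJT`, so ramified places are allowed; `ψ` = ★ `localNonsplitCongr`,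
`(ψ g)_w = T g_w T⁻¹`): `ψ` preserves the hyperspecial levels, and `ψ g` is `GL₃(∏_{w′∣v} L_{w′})`-conjugate to `g` (so that matching
relations and regularity transport). [cite: Rogawski1990, §14.2 p. 233] [cite: Jacobowitz1962, §7 Thm. 7.1] -/
theorem exists_continuousMulEquiv_level_isConj_of_formCongr (L : Type) [Field L] [NumberField L] [IsCMField L]
    (H' : Matrix (Fin 3) (Fin 3) L)
    {v : HeightOneSpectrum (𝓞 ↥(maximalRealSubfield L))} (w : PlacesOver L v) (hw : IsCMField.complexConj L • w.1 = w.1)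
    (hJT : ∃ T : GL (Fin 3) (w.1.adicCompletion L), T ∈ glInt 3 (w.1.adicCompletion L) ∧
      placeForm H' w.1 = formCongr (galAdicCompletionMap (L := L) (IsCMField.complexConj L) hw) T ((StdForm.antidiagonal 3).over (w.1.adicCompletion L))) :
    ∃ ψ : (cmDatum L 3 H').Local v ≃ₜ* ↥(unitaryGroupOfForm (conjLocal L (IsCMField.complexConj L) v) (cmLocalForm L 3 v)),
      (∀ g, ψ g ∈ cmLocalIntegralLevel L 3 (Matrix.of fun i j : Fin 3 => if i.val + j.val + 1 = 3 then (1 : L) else 0) v ↔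
          g ∈ cmLocalIntegralLevel L 3 H' v) ∧
      (∀ g, IsConj ((g.val : GL (Fin 3) (LocalRing L v)))
          (((ψ g : ↥(unitaryGroupOfForm (conjLocal L (IsCMField.complexConj L) v) (cmLocalForm L 3 v))) : GL (Fin 3) (LocalRing L v)))) ∧
      ∃ T : GL (Fin 3) (w.1.adicCompletion L), T ∈ glInt 3 (w.1.adicCompletion L) ∧ ∀ g,
        ((localNonsplitEquiv (IsCMField.complexConj L) (Matrix.of fun i j : Fin 3 => if i.val + j.val + 1 = 3 then (1 : L) else 0)
            (IsCMField.complexConj_ne_one L) w hw (ψ g) :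
            unitaryGroupOfForm (galAdicCompletionMap (L := L) (IsCMField.complexConj L) hw)
              (placeForm (Matrix.of fun i j : Fin 3 => if i.val + j.val + 1 = 3 then (1 : L) else 0) w.1)) :
            GL (Fin 3) (w.1.adicCompletion L)) =
          T * ((localNonsplitEquiv (IsCMField.complexConj L) H' (IsCMField.complexConj_ne_one L) w hw g :
            unitaryGroupOfForm (galAdicCompletionMap (L := L) (IsCMField.complexConj L) hw) (placeForm H' w.1)) :
            GL (Fin 3) (w.1.adicCompletion L)) * T⁻¹ := by
  have hc := IsCMField.complexConj_ne_one L
  haveI : Algebra.IsQuadraticExtension ↥(maximalRealSubfield L) L := IsCMField.isQuadraticExtension L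
  obtain ⟨T, hT, hJT⟩ := hJT
  have h : formCongr (galAdicCompletionMap (L := L) (IsCMField.complexConj L) hw) T
      (placeForm (Matrix.of fun i j : Fin 3 => if i.val + j.val + 1 = 3 then (1 : L) else 0) w.1) =
        (1 : w.1.adicCompletion L) • placeForm H' w.1 := by
    rw [one_smul, placeForm_antidiagOne, ← hJT]
  refine ⟨localNonsplitCongr (IsCMField.complexConj L) hc w hw T isUnit_one h, fun g => ?_, fun g => ?_, T, hT, fun g =>
    localNonsplitEquiv_localNonsplitCongr (IsCMField.complexConj L) hc w hw T isUnit_one h g⟩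
  · -- level preservation
    have e1 := mem_localIntegralLevel_iff_of_smul_eq (IsCMField.complexConj L) 3
      (Matrix.of fun i j : Fin 3 => if i.val + j.val + 1 = 3 then (1 : L) else 0) hc w hw
      (localNonsplitCongr (IsCMField.complexConj L) hc w hw T isUnit_one h g)
    have e2 := mem_localIntegralLevel_iff_of_smul_eq (IsCMField.complexConj L) 3 H' hc w hw g
    refine (e1.trans ?_).trans e2.symm
    rw [localNonsplitEquiv_localNonsplitCongr]
    constructor
    · intro h'
      have h'' := Subgroup.mul_mem _ (Subgroup.mul_mem _ (Subgroup.inv_mem _ hT) h') hT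
      simpa only [mul_assoc, mul_inv_cancel_left, inv_mul_cancel, mul_one, inv_mul_cancel_left] using h''
    · intro h'
      exact Subgroup.mul_mem _ (Subgroup.mul_mem _ hT h') (Subgroup.inv_mem _ hT)
  · -- conjugacy in `GL₃(∏ L_{w′})` from the one-component conjugacy
    refine isConj_of_isConj_mulEquiv'
      ((localGLPiEquiv L 3 v).toMulEquiv.trans (localGLPiEvalEquiv (IsCMField.complexConj L) 3 hc w hw).toMulEquiv) ?_
    show IsConj
      ((localNonsplitEquiv (IsCMField.complexConj L) H' hc w hw g :
        unitaryGroupOfForm (galAdicCompletionMap (L := L) (IsCMField.complexConj L) hw) (placeForm H' w.1)) :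
        GL (Fin 3) (w.1.adicCompletion L))
      ((localNonsplitEquiv (IsCMField.complexConj L)
        (Matrix.of fun i j : Fin 3 => if i.val + j.val + 1 = 3 then (1 : L) else 0) hc w hw
          (localNonsplitCongr (IsCMField.complexConj L) hc w hw T isUnit_one h g) :
        unitaryGroupOfForm (galAdicCompletionMap (L := L) (IsCMField.complexConj L) hw)
          (placeForm (Matrix.of fun i j : Fin 3 => if i.val + j.val + 1 = 3 then (1 : L) else 0) w.1)) :
        GL (Fin 3) (w.1.adicCompletion L))
    rw [localNonsplitEquiv_localNonsplitCongr]
    exact isConj_iff.2 ⟨T, rfl⟩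

/-! ## §2 The unit orbital integral at a regular split-torus class (hypothesis form) -/

set_option maxHeartbeats 1600000 in
-- instance-term unification on the CM local carriers (as in ★ `lintegral_conj_cmBorel_eq_mul_lintegral_mul`); < 60 s
/-- **THE UNIT ORBITAL INTEGRAL OF THE INNER FORM AT A SPLIT-TORUS CLASS, NON-SPLIT PLACE** (the `G`-side of [Rogawski1990] Prop. 4.9.1 (b) in
the Levi case, (4.9.2) «`Φ(γ, 1_K) = |D(γ)|⁻¹(1_K)^{(B)}(γ)`», with the compatible measures of §4.3).  At a finite place `v` of `L⁺` NON-SPLIT in `L` (any ramification)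
where `H′_w` is integrally congruent to `Φ₃` (binder `hJT`; e.g. `H′ = Φ₃` itself, `T = 1`, at EVERY place — the corollary below): for a canonical orbital measure family `mG` on `U(H′)(L⁺_v)` (predicate
`IsRegularElt`, Haar `νG` with `νG(K′) = 1`) and a REGULAR INTEGRAL diagonal `t = diag(d) ∈ T(𝒪_v) ≤ U(Φ₃)(L⁺_v)` (`dᵢ − dⱼ` units), there is
`γ₀ ∈ K′ = U(H′)(𝒪_v)`, `GL₃(∏ L_w)`-conjugate to `t` (hence matching every `γ_H` with `ι_v γ_H = t`), whose unit orbital integral is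
**`Φ(⟦γ₀⟧, 1_{K′}) = (‖d₀⁻¹d₁ − 1‖ · χ⁻(d₀⁻¹d₂ − 1))⁻¹`** — ★ A-p12's twist module `J_G(t)` (`UnitaryGroupHeisenbergRingRegularTwist`),
through ψ : U(H′)_v ≃ U(Φ₃)_v (`exists_continuousMulEquiv_level_isConj_of_formCongr`), ★ `TorusOrbitalDescentUnitCanonical` §2, ★ B-p12
`exists_measure_quotient_torusU_cmLocal_eq_smul_map`, `Z(t) = T` and `compactCore T ⊆ K` (★ `RegularDiagonalCentralizer`).
[cite: Rogawski1990, §4.9 Prop. 4.9.1 (b), (4.9.2) p. 55; §4.3 (4.3.1) p. 43; §14.2 p. 233] [cite: DeitmarEchterhoff2014, Thm. 1.5.3] -/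
theorem exists_classOrbitalIntegral_indicator_eq_twist_of_torus_regular_of_formCongr
    (L : Type) [Field L] [NumberField L] [IsCMField L] (H' : Matrix (Fin 3) (Fin 3) L)
    (hH' : (H'.map (IsCMField.complexConj L))ᵀ = H') (hH'd : IsUnit H'.det)
    {v : HeightOneSpectrum (𝓞 ↥(maximalRealSubfield L))} (w : PlacesOver L v)
    (hw : IsCMField.complexConj L • w.1 = w.1)
    (hJT : ∃ T : GL (Fin 3) (w.1.adicCompletion L), T ∈ glInt 3 (w.1.adicCompletion L) ∧
      placeForm H' w.1 = formCongr (galAdicCompletionMap (L := L) (IsCMField.complexConj L) hw) T ((StdForm.antidiagonal 3).over (w.1.adicCompletion L)))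
    [MeasurableSpace ((cmDatum L 3 H').Local v)] [BorelSpace ((cmDatum L 3 H').Local v)]
    [∀ γ : (cmDatum L 3 H').Local v, MeasurableSpace (((cmDatum L 3 H').Local v) ⧸ Subgroup.centralizer ({γ} : Set ((cmDatum L 3 H').Local v)))]
    [∀ γ : (cmDatum L 3 H').Local v, BorelSpace (((cmDatum L 3 H').Local v) ⧸ Subgroup.centralizer ({γ} : Set ((cmDatum L 3 H').Local v)))]
    (νG : Measure ((cmDatum L 3 H').Local v)) [νG.IsHaarMeasure] [νG.IsMulRightInvariant]
    {mG : OrbitalMeasureFamily ((cmDatum L 3 H').Local v)}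
    (hmG : mG.IsCanonical (fun γ => IsRegularElt (γ.val : GL (Fin 3) (LocalRing L v))) νG)
    (hνG : νG (cmLocalIntegralLevel L 3 H' v : Set ((cmDatum L 3 H').Local v)) = 1)
    (t : ↥(torusU (conjLocal L (IsCMField.complexConj L) v) (cmLocalForm L 3 v))) {d : Fin 3 → (LocalRing L v)ˣ}
    (hd : glDiagonal 3 (LocalRing L v) d =
      ((t : ↥(unitaryGroupOfForm (conjLocal L (IsCMField.complexConj L) v) (cmLocalForm L 3 v))) : GL (Fin 3) (LocalRing L v)))
    (hreg : ∀ i j, i ≠ j → IsUnit ((d i : LocalRing L v) - d j))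
    (htreg : IsRegularElt ((t : ↥(unitaryGroupOfForm (conjLocal L (IsCMField.complexConj L) v) (cmLocalForm L 3 v))) : GL (Fin 3) (LocalRing L v)))
    (ha : IsUnit ((((d 0)⁻¹ * d 1 : (LocalRing L v)ˣ) : LocalRing L v) - 1))
    (hb : IsUnit ((((d 0)⁻¹ * d 2 : (LocalRing L v)ˣ) : LocalRing L v) - 1))
    (htK : (t : ↥(unitaryGroupOfForm (conjLocal L (IsCMField.complexConj L) v) (cmLocalForm L 3 v))) ∈
      cmLocalIntegralLevel L 3 (Matrix.of fun i j : Fin 3 => if i.val + j.val + 1 = 3 then (1 : L) else 0) v) :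
    ∃ γ₀ : (cmDatum L 3 H').Local v, γ₀ ∈ cmLocalIntegralLevel L 3 H' v ∧
      IsConj (((t : ↥(unitaryGroupOfForm (conjLocal L (IsCMField.complexConj L) v) (cmLocalForm L 3 v))) : GL (Fin 3) (LocalRing L v)))
        (γ₀.val : GL (Fin 3) (LocalRing L v)) ∧
      classOrbitalIntegral mG ((cmLocalIntegralLevel L 3 H' v : Set ((cmDatum L 3 H').Local v)).indicator fun _ => (1 : ℂ))
          (ConjClasses.mk γ₀) =
        (((letI : MeasurableSpace (LocalRing L v) := borel _; haveI : BorelSpace (LocalRing L v) := ⟨rfl⟩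
          haveI : SecondCountableTopology (LocalRing L v) := secondCountableTopology_localRing (E := L) v
          ((distribHaarChar (LocalRing L v) ha.unit)⁻¹ *
            (HeisRing.skewModulus (conjLocal L (IsCMField.complexConj L) v) (continuous_conjLocal L (IsCMField.complexConj L) v) hb.unit
              (HeisRing.map_unit_torusCentralScalar_sub_one (conjLocal L (IsCMField.complexConj L) v) (cmLocalForm_eq_over L 3 v) t hd hb))⁻¹ :
                ℝ≥0)) : ℝ) : ℂ) := by
  have hc := IsCMField.complexConj_ne_one L
  haveI : Algebra.IsQuadraticExtension ↥(maximalRealSubfield L) L := IsCMField.isQuadraticExtension L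
  -- Step 1: the comparison `ψ`, the match `γ₀ := ψ⁻¹ t`
  obtain ⟨ψ, hlev, hconjψ, -⟩ := exists_continuousMulEquiv_level_isConj_of_formCongr L H' w hw hJT
  set G3 := ↥(unitaryGroupOfForm (conjLocal L (IsCMField.complexConj L) v) (cmLocalForm L 3 v)) with hG3
  set t' : ↥(unitaryGroupOfForm (conjLocal L (IsCMField.complexConj L) v) (cmLocalForm L 3 v)) :=
    (t : ↥(unitaryGroupOfForm (conjLocal L (IsCMField.complexConj L) v) (cmLocalForm L 3 v))) with ht'
  set γ₀ : (cmDatum L 3 H').Local v := ψ.symm t' with hγ₀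
  have hψγ : ψ γ₀ = t' := ψ.apply_symm_apply t'
  have hψγ' : ψ.toMulEquiv γ₀ = t' := hψγ
  have hγ₀K : γ₀ ∈ cmLocalIntegralLevel L 3 H' v := (hlev γ₀).1 (hψγ ▸ htK)
  have hconj : IsConj ((t' : GL (Fin 3) (LocalRing L v))) (γ₀.val : GL (Fin 3) (LocalRing L v)) := by
    have h1 := hconjψ γ₀
    rw [hψγ] at h1
    exact h1.symm
  have hreg₀ : IsRegularElt (γ₀.val : GL (Fin 3) (LocalRing L v)) := isRegularElt_of_isConj hconj htreg
  refine ⟨γ₀, hγ₀K, hconj, ?_⟩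
  -- Step 2: the canonical measure at `γ₀`; the class orbital integral as a `lintegral`
  letI : MeasurableSpace («local» L (IsCMField.complexConj L) 3 H' v) := ‹MeasurableSpace ((cmDatum L 3 H').Local v)›
  haveI : BorelSpace («local» L (IsCMField.complexConj L) 3 H' v) := ‹BorelSpace ((cmDatum L 3 H').Local v)›
  obtain ⟨tZ, htZ, htZi, htZ1⟩ : ∃ t : Measure ↥(Subgroup.centralizer ({γ₀} : Set ((cmDatum L 3 H').Local v))),
      t.IsHaarMeasure ∧ t.IsInvInvariant ∧ t (compactCore (↥(Subgroup.centralizer ({γ₀} : Set ((cmDatum L 3 H').Local v))))) = 1 :=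
    forall_isRegularElt_exists_isHaarMeasure_compactCore_centralizer_local_eq_one (IsCMField.complexConj L) 3 H' hc hH' hH'd γ₀ hreg₀
  haveI := htZ
  haveI := htZi
  have hP : ∀ g x : (cmDatum L 3 H').Local v, IsRegularElt (g.val : GL (Fin 3) (LocalRing L v)) →
      IsRegularElt ((x * g * x⁻¹).val : GL (Fin 3) (LocalRing L v)) := fun g x hg =>
    (Literature.NumberTheory.Rogawski1990.isRegularElt_conj_iff (x.val : GL (Fin 3) (LocalRing L v)) (g.val : GL (Fin 3) (LocalRing L v))).2 hg
  have hK'co := isCompact_isOpen_cmLocalIntegralLevel L 3 H' v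
  rw [hmG.classOrbitalIntegral_mk_eq_orbitalIntegral' hP hreg₀ tZ htZ1,
    orbitalIntegral_indicator_complex_eq_ofReal γ₀ (cmLocalIntegralLevel L 3 H' v),
    orbitalIntegral_indicator_eq_toReal_lintegral γ₀ (cmLocalIntegralLevel L 3 H' v) hK'co.2]
  -- Step 3: structure on `G₃ = U(Φ₃)(L⁺_v)` and the transported measures
  letI mG3 : MeasurableSpace G3 := borel _
  haveI : BorelSpace G3 := ⟨rfl⟩
  haveI : LocallyCompactSpace G3 := locallyCompactSpace_local (IsCMField.complexConj L) 3 _ v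
  haveI : SecondCountableTopology G3 := secondCountableTopology_local (IsCMField.complexConj L) 3 _ v
  letI mQ : MeasurableSpace (G3 ⧸ torusU (conjLocal L (IsCMField.complexConj L) v) (cmLocalForm L 3 v)) := borel _
  haveI : BorelSpace (G3 ⧸ torusU (conjLocal L (IsCMField.complexConj L) v) (cmLocalForm L 3 v)) := ⟨rfl⟩
  -- `Ψ Z(γ₀) = T`
  have hZT : ∀ g : (cmDatum L 3 H').Local v, ψ.toMulEquiv g ∈ torusU (conjLocal L (IsCMField.complexConj L) v) (cmLocalForm L 3 v) ↔
      g ∈ Subgroup.centralizer ({γ₀} : Set ((cmDatum L 3 H').Local v)) := by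
    intro g
    rw [mem_torusU_iff_mem_centralizer_of_isUnit_sub hd hreg, Subgroup.mem_centralizer_singleton_iff,
      Subgroup.mem_centralizer_singleton_iff, ← hψγ]
    change ψ g * ψ γ₀ = ψ γ₀ * ψ g ↔ g * γ₀ = γ₀ * g
    rw [← map_mul, ← map_mul, ψ.injective.eq_iff]
  -- the transported Haar measures
  obtain ⟨ν, hν⟩ : ∃ ν : Measure G3, ν = Measure.map ψ.toMulEquiv νG := ⟨_, rfl⟩
  haveI : ν.IsHaarMeasure := by rw [hν]; exact MulEquiv.isHaarMeasure_map νG ψ.toMulEquiv ψ.continuous ψ.symm.continuous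
  haveI : ν.IsMulRightInvariant := by
    rw [hν]; exact isMulRightInvariant_map_mulEquiv_of_isMulRightInvariant ψ.toMulEquiv ψ.continuous.measurable νG
  haveI hZc : IsClosed ((Subgroup.centralizer ({γ₀} : Set ((cmDatum L 3 H').Local v)) : Subgroup ((cmDatum L 3 H').Local v)) :
      Set ((cmDatum L 3 H').Local v)) := isClosed_coe_centralizer_singleton γ₀
  have hT : IsClosed ((torusU (conjLocal L (IsCMField.complexConj L) v) (cmLocalForm L 3 v) : Subgroup G3) : Set G3) :=
    isClosed_cmBorelTriple_M L v
  haveI : LocallyCompactSpace ↥(Subgroup.centralizer ({γ₀} : Set ((cmDatum L 3 H').Local v))) :=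
    hZc.isClosedEmbedding_subtypeVal.locallyCompactSpace
  haveI : SecondCountableTopology ↥(Subgroup.centralizer ({γ₀} : Set ((cmDatum L 3 H').Local v))) :=
    TopologicalSpace.Subtype.secondCountableTopology _
  haveI : LocallyCompactSpace ↥(torusU (conjLocal L (IsCMField.complexConj L) v) (cmLocalForm L 3 v)) :=
    hT.isClosedEmbedding_subtypeVal.locallyCompactSpace
  haveI : SecondCountableTopology ↥(torusU (conjLocal L (IsCMField.complexConj L) v) (cmLocalForm L 3 v)) :=
    TopologicalSpace.Subtype.secondCountableTopology _
  let eH := subgroupCongrHomeomorph ψ.toMulEquiv (Subgroup.centralizer ({γ₀} : Set ((cmDatum L 3 H').Local v)))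
    (torusU (conjLocal L (IsCMField.complexConj L) v) (cmLocalForm L 3 v)) hZT ψ.continuous ψ.symm.continuous
  let eZ : ↥(Subgroup.centralizer ({γ₀} : Set ((cmDatum L 3 H').Local v))) ≃ₜ*
      ↥(torusU (conjLocal L (IsCMField.complexConj L) v) (cmLocalForm L 3 v)) :=
    { toMulEquiv :=
        { toEquiv := eH.toEquiv
          map_mul' := fun a b => Subtype.ext (map_mul ψ (a : (cmDatum L 3 H').Local v) (b : (cmDatum L 3 H').Local v)) }
      continuous_toFun := eH.continuous
      continuous_invFun := eH.symm.continuous }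
  have heZ : (eZ : _ → ↥(torusU (conjLocal L (IsCMField.complexConj L) v) (cmLocalForm L 3 v))) = eH := rfl
  obtain ⟨tT, htT⟩ : ∃ tT : Measure ↥(torusU (conjLocal L (IsCMField.complexConj L) v) (cmLocalForm L 3 v)), tT = Measure.map eH tZ :=
    ⟨_, rfl⟩
  haveI : tT.IsHaarMeasure := by
    rw [htT, ← heZ]; exact MulEquiv.isHaarMeasure_map tZ eZ.toMulEquiv eZ.continuous eZ.symm.continuous
  haveI : tT.IsInvInvariant := by
    rw [htT, ← heZ]; exact isInvInvariant_map_mulEquiv eZ.toMulEquiv eZ.continuous.measurable tZ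
  -- Step 4: the level `K₃`, Haar measures on `K₃`, `N`, `T`, and the Iwasawa form of `ν∕t_T`
  obtain ⟨K3, hK3⟩ : ∃ K3 : Subgroup G3,
      K3 = cmLocalIntegralLevel L 3 (Matrix.of fun i j : Fin 3 => if i.val + j.val + 1 = 3 then (1 : L) else 0) v := ⟨_, rfl⟩
  have hK3co : IsCompact (K3 : Set G3) ∧ IsOpen (K3 : Set G3) := by
    rw [hK3]; exact isCompact_isOpen_cmLocalIntegralLevel L 3 (Matrix.of fun i j : Fin 3 => if i.val + j.val + 1 = 3 then (1 : L) else 0) v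
  haveI : LocallyCompactSpace ↥K3 := hK3co.1.isClosed.isClosedEmbedding_subtypeVal.locallyCompactSpace
  haveI : LocallyCompactSpace ↥(unipotentU (conjLocal L (IsCMField.complexConj L) v) (cmLocalForm L 3 v)) :=
    (isClosed_cmBorelTriple_N L v).isClosedEmbedding_subtypeVal.locallyCompactSpace
  haveI : SecondCountableTopology ↥(unipotentU (conjLocal L (IsCMField.complexConj L) v) (cmLocalForm L 3 v)) :=
    TopologicalSpace.Subtype.secondCountableTopology _
  obtain ⟨κ, hκ⟩ : ∃ κ : Measure ↥K3, κ.IsHaarMeasure := ⟨Measure.haar, inferInstance⟩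
  obtain ⟨μN, hμN⟩ : ∃ μN : Measure ↥(unipotentU (conjLocal L (IsCMField.complexConj L) v) (cmLocalForm L 3 v)), μN.IsHaarMeasure :=
    ⟨Measure.haar, inferInstance⟩
  obtain ⟨α, hα⟩ : ∃ α : Measure ↥(torusU (conjLocal L (IsCMField.complexConj L) v) (cmLocalForm L 3 v)), α.IsHaarMeasure :=
    ⟨Measure.haar, inferInstance⟩
  haveI : SMulInvariantMeasure G3 (G3 ⧸ torusU (conjLocal L (IsCMField.complexConj L) v) (cmLocalForm L 3 v))
      (quotientMeasure (torusU (conjLocal L (IsCMField.complexConj L) v) (cmLocalForm L 3 v)) tT hT ν) :=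
    smulInvariantMeasure_quotientMeasure _ tT hT ν
  have hμ0 : quotientMeasure (torusU (conjLocal L (IsCMField.complexConj L) v) (cmLocalForm L 3 v)) tT hT ν ≠ 0 :=
    quotientMeasure_ne_zero _ tT hT ν
  have hKB : ∀ g : G3, ∃ k ∈ K3, ∃ b ∈ borelU (conjLocal L (IsCMField.complexConj L) v) (cmLocalForm L 3 v), g = k * b := fun g => by
    obtain ⟨k, hk, b, hb⟩ := exists_mem_cmLocalIntegralLevel_mul_borel L 3 v g
    exact ⟨k, by rw [hK3]; exact hk, b.1, b.2, hb⟩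
  obtain ⟨C, -, hμC⟩ := exists_measure_quotient_torusU_cmLocal_eq_smul_map L v hK3co.1 hKB κ α μN
    (quotientMeasure (torusU (conjLocal L (IsCMField.complexConj L) v) (cmLocalForm L 3 v)) tT hT ν) hμ0
  -- Step 5: the two normalisations `ν(K₃) = 1`, `t_T(T ∩ K₃) = 1`
  have hK' : ∀ g : (cmDatum L 3 H').Local v, g ∈ cmLocalIntegralLevel L 3 H' v ↔ ψ.toMulEquiv g ∈ K3 := fun g => by
    rw [hK3]; exact (hlev g).symm
  have hψm : Measurable (ψ.toMulEquiv : (cmDatum L 3 H').Local v → G3) := ψ.continuous.measurable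
  have hν1 : ν K3 = 1 := by
    rw [hν, Measure.map_apply hψm hK3co.2.measurableSet]
    have hpre : (ψ.toMulEquiv : (cmDatum L 3 H').Local v → G3) ⁻¹' (K3 : Set G3) = (cmLocalIntegralLevel L 3 H' v : Set ((cmDatum L 3 H').Local v)) := by
      ext g; exact (hK' g).symm
    rw [hpre, hνG]
  -- the `w`-component of `t` is the regular diagonal `diag(d_w)`
  have hγmat : (((localNonsplitEquiv (IsCMField.complexConj L) (Matrix.of fun i j : Fin 3 => if i.val + j.val + 1 = 3 then (1 : L) else 0)
        hc w hw (ψ.toMulEquiv γ₀) : ↥(unitaryGroupOfForm (galAdicCompletionMap (L := L) (IsCMField.complexConj L) hw)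
          (placeForm (Matrix.of fun i j : Fin 3 => if i.val + j.val + 1 = 3 then (1 : L) else 0) w.1))) :
        GL (Fin 3) (w.1.adicCompletion L)) : Matrix (Fin 3) (Fin 3) (w.1.adicCompletion L)) =
      Matrix.diagonal fun i => ((d i : (LocalRing L v)ˣ) : LocalRing L v) w := by
    rw [coe_coe_localNonsplitEquiv_apply, hψγ', ← hd, coe_glDiagonal,
      Matrix.diagonal_map (RingHom.map_zero (Pi.evalRingHom (fun w' : PlacesOver L v => w'.1.adicCompletion L) w))]
    rfl
  have hdw : ∀ i j : Fin 3, i ≠ j → IsUnit (((d i : (LocalRing L v)ˣ) : LocalRing L v) w - ((d j : (LocalRing L v)ˣ) : LocalRing L v) w) := by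
    intro i j hij
    have h1 := (hreg i j hij).map (Pi.evalRingHom (fun w' : PlacesOver L v => w'.1.adicCompletion L) w)
    rwa [map_sub] at h1
  have hcore : compactCore ↥(Subgroup.centralizer ({γ₀} : Set ((cmDatum L 3 H').Local v))) ⊆
      Subtype.val ⁻¹' (cmLocalIntegralLevel L 3 H' v : Set ((cmDatum L 3 H').Local v)) := by
    -- read in `GL₃(L_w)` through `ψ` and the one-place model of `U(Φ₃)`
    refine compactCore_centralizer_subset_of_hom 3 (w.1)
      ((unitaryGroupOfForm (galAdicCompletionMap (L := L) (IsCMField.complexConj L) hw)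
          (placeForm (Matrix.of fun i j : Fin 3 => if i.val + j.val + 1 = 3 then (1 : L) else 0) w.1)).subtype.comp
        ((localNonsplitEquiv (IsCMField.complexConj L) (Matrix.of fun i j : Fin 3 => if i.val + j.val + 1 = 3 then (1 : L) else 0)
          hc w hw).toMulEquiv.toMonoidHom.comp ψ.toMulEquiv.toMonoidHom))
      (continuous_subtype_val.comp ((localNonsplitEquiv (IsCMField.complexConj L)
        (Matrix.of fun i j : Fin 3 => if i.val + j.val + 1 = 3 then (1 : L) else 0) hc w hw).continuous.comp ψ.continuous))
      (cmLocalIntegralLevel L 3 H' v) (fun g => ?_) γ₀ _ rfl ?_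
    · exact (hlev g).symm.trans (mem_localIntegralLevel_iff_of_smul_eq (IsCMField.complexConj L) 3 _ hc w hw (ψ g))
    · intro C' hC' hC'Z
      exact subgroup_le_glInt_of_isCompact_of_le_centralizer_diagonal 3 (w.1) hγmat hdw C' hC' hC'Z
  have htK1 : tT (Subtype.val ⁻¹' (K3 : Set G3)) = 1 := by
    rw [htT, Measure.map_apply eH.continuous.measurable (hK3co.2.preimage continuous_subtype_val).measurableSet]
    have hpre : (eH : _ → ↥(torusU (conjLocal L (IsCMField.complexConj L) v) (cmLocalForm L 3 v))) ⁻¹' (Subtype.val ⁻¹' (K3 : Set G3)) =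
        Subtype.val ⁻¹' (cmLocalIntegralLevel L 3 H' v : Set ((cmDatum L 3 H').Local v)) := by
      ext z
      simp only [Set.mem_preimage]
      exact (hK' (z : (cmDatum L 3 H').Local v)).symm
    rw [hpre]
    exact measure_preimage_eq_one_of_compactCore_subset _ tZ htZ1 (cmLocalIntegralLevel L 3 H' v) hK'co.1 hcore
  -- Step 6: the twist module (★ A-p12) and the transported torus descent (★ FILE B §2)
  have hTN : ∀ a ∈ torusU (conjLocal L (IsCMField.complexConj L) v) (cmLocalForm L 3 v),
      ∀ n ∈ unipotentU (conjLocal L (IsCMField.complexConj L) v) (cmLocalForm L 3 v),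
        a * n * a⁻¹ ∈ unipotentU (conjLocal L (IsCMField.complexConj L) v) (cmLocalForm L 3 v) :=
    fun a ha n hn => conj_mem_unipotentU_cmLocal L v ha hn
  have hKP : ∀ ⦃m u : G3⦄, m ∈ torusU (conjLocal L (IsCMField.complexConj L) v) (cmLocalForm L 3 v) →
      u ∈ unipotentU (conjLocal L (IsCMField.complexConj L) v) (cmLocalForm L 3 v) → m * u ∈ K3 → m ∈ K3 := by
    rw [hK3]; exact mem_cmLocalIntegralLevel_of_torus_mul_unipotent L 3 v
  have htT' : ψ.toMulEquiv γ₀ ∈ torusU (conjLocal L (IsCMField.complexConj L) v) (cmLocalForm L 3 v) := by rw [hψγ']; exact t.2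
  have ht' : ∀ a ∈ torusU (conjLocal L (IsCMField.complexConj L) v) (cmLocalForm L 3 v), a * ψ.toMulEquiv γ₀ = ψ.toMulEquiv γ₀ * a := by
    rw [hψγ']; exact forall_mem_torusU_cmLocal_comm L v t.2
  have hJac : ∀ Φ : G3 → ℝ≥0∞, Measurable Φ →
      ∫⁻ n, Φ ((n : G3) * ψ.toMulEquiv γ₀ * (n : G3)⁻¹) ∂μN =
        ((letI : MeasurableSpace (LocalRing L v) := borel _; haveI : BorelSpace (LocalRing L v) := ⟨rfl⟩
          haveI : SecondCountableTopology (LocalRing L v) := secondCountableTopology_localRing (E := L) v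
          ((distribHaarChar (LocalRing L v) ha.unit)⁻¹ *
            (HeisRing.skewModulus (conjLocal L (IsCMField.complexConj L) v) (continuous_conjLocal L (IsCMField.complexConj L) v) hb.unit
              (HeisRing.map_unit_torusCentralScalar_sub_one (conjLocal L (IsCMField.complexConj L) v) (cmLocalForm_eq_over L 3 v) t hd hb))⁻¹ :
                ℝ≥0)) : ℝ≥0∞) * ∫⁻ n, Φ (ψ.toMulEquiv γ₀ * (n : G3)) ∂μN := by
    intro Φ hΦ
    rw [hψγ']
    exact lintegral_conj_cmBorel_eq_mul_lintegral_mul L v μN t hd ha hb Φ hΦ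
  have key := lintegral_descConj_centralizer_indicator_eq_of_mulEquiv (G := G3) hK3co.2 hT hTN hKP ν tT κ μN ψ.toMulEquiv
    ψ.continuous ψ.symm.continuous γ₀ hZT νG hν tZ htT (cmLocalIntegralLevel L 3 H' v) hK' hμC hν1 htK1 htT' ht' hJac
  rw [key, hψγ', Set.indicator_of_mem (show t' ∈ (K3 : Set G3) by rw [hK3]; exact htK), Pi.one_apply, mul_one,
    ENNReal.coe_toReal]


/-! ## §3 The quasi-split form `H′ = Φ₃`: no hypothesis on the place beyond non-splitness -/

set_option maxHeartbeats 1600000 in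
-- instance-term unification on the CM local carriers, as in §2
/-- **THE UNIT ORBITAL INTEGRAL OF `U(Φ₃)(L⁺_v) = U(2,1)` AT A REGULAR SPLIT-TORUS CLASS, ANY NON-SPLIT PLACE (tame or WILD)**: §2 at `H′ = Φ₃` with the congruence
binder discharged by `T = 1` (★ `formCongr_one_eq`, ★ `placeForm_antidiagOne`; `Φ₃` is hermitian ★ `antidiagOne_map_transpose` with unit determinant ★ `isUnit_antidiagOne_det`):
for a regular integral diagonal `t = diag(d) ∈ T(𝒪_v)` there is `γ₀ ∈ K₀ = U(Φ₃)(𝒪_v)` conjugate to `t` with **`Φ(⟦γ₀⟧, 1_{K₀}) = (‖d₀⁻¹d₁ − 1‖ · χ⁻(d₀⁻¹d₂ − 1))⁻¹`** —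
the `G`-side Levi value of the FOUR-FRAME anchor piece `1_{K₀}` at a dyadic ramified place. [cite: Rogawski1990, §4.9 Prop. 4.9.1 (b), (4.9.2) p. 55; §4.3 (4.3.1) p. 43]
[cite: DeitmarEchterhoff2014, Thm. 1.5.3] -/
theorem exists_classOrbitalIntegral_indicator_eq_twist_of_torus_regular_antidiagOne
    (L : Type) [Field L] [NumberField L] [IsCMField L]
    {v : HeightOneSpectrum (𝓞 ↥(maximalRealSubfield L))} (w : PlacesOver L v)
    (hw : IsCMField.complexConj L • w.1 = w.1)
    [MeasurableSpace ((cmDatum L 3 (Matrix.of fun i j : Fin 3 => if i.val + j.val + 1 = 3 then (1 : L) else 0)).Local v)] [BorelSpace ((cmDatum L 3 (Matrix.of fun i j : Fin 3 => if i.val + j.val + 1 = 3 then (1 : L) else 0)).Local v)]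
    [∀ γ : (cmDatum L 3 (Matrix.of fun i j : Fin 3 => if i.val + j.val + 1 = 3 then (1 : L) else 0)).Local v, MeasurableSpace (((cmDatum L 3 (Matrix.of fun i j : Fin 3 => if i.val + j.val + 1 = 3 then (1 : L) else 0)).Local v) ⧸ Subgroup.centralizer ({γ} : Set ((cmDatum L 3 (Matrix.of fun i j : Fin 3 => if i.val + j.val + 1 = 3 then (1 : L) else 0)).Local v)))]
    [∀ γ : (cmDatum L 3 (Matrix.of fun i j : Fin 3 => if i.val + j.val + 1 = 3 then (1 : L) else 0)).Local v, BorelSpace (((cmDatum L 3 (Matrix.of fun i j : Fin 3 => if i.val + j.val + 1 = 3 then (1 : L) else 0)).Local v) ⧸ Subgroup.centralizer ({γ} : Set ((cmDatum L 3 (Matrix.of fun i j : Fin 3 => if i.val + j.val + 1 = 3 then (1 : L) else 0)).Local v)))]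
    (νG : Measure ((cmDatum L 3 (Matrix.of fun i j : Fin 3 => if i.val + j.val + 1 = 3 then (1 : L) else 0)).Local v)) [νG.IsHaarMeasure] [νG.IsMulRightInvariant]
    {mG : OrbitalMeasureFamily ((cmDatum L 3 (Matrix.of fun i j : Fin 3 => if i.val + j.val + 1 = 3 then (1 : L) else 0)).Local v)}
    (hmG : mG.IsCanonical (fun γ => IsRegularElt (γ.val : GL (Fin 3) (LocalRing L v))) νG)
    (hνG : νG (cmLocalIntegralLevel L 3 (Matrix.of fun i j : Fin 3 => if i.val + j.val + 1 = 3 then (1 : L) else 0) v : Set ((cmDatum L 3 (Matrix.of fun i j : Fin 3 => if i.val + j.val + 1 = 3 then (1 : L) else 0)).Local v)) = 1)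
    (t : ↥(torusU (conjLocal L (IsCMField.complexConj L) v) (cmLocalForm L 3 v))) {d : Fin 3 → (LocalRing L v)ˣ}
    (hd : glDiagonal 3 (LocalRing L v) d =
      ((t : ↥(unitaryGroupOfForm (conjLocal L (IsCMField.complexConj L) v) (cmLocalForm L 3 v))) : GL (Fin 3) (LocalRing L v)))
    (hreg : ∀ i j, i ≠ j → IsUnit ((d i : LocalRing L v) - d j))
    (htreg : IsRegularElt ((t : ↥(unitaryGroupOfForm (conjLocal L (IsCMField.complexConj L) v) (cmLocalForm L 3 v))) : GL (Fin 3) (LocalRing L v)))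
    (ha : IsUnit ((((d 0)⁻¹ * d 1 : (LocalRing L v)ˣ) : LocalRing L v) - 1))
    (hb : IsUnit ((((d 0)⁻¹ * d 2 : (LocalRing L v)ˣ) : LocalRing L v) - 1))
    (htK : (t : ↥(unitaryGroupOfForm (conjLocal L (IsCMField.complexConj L) v) (cmLocalForm L 3 v))) ∈
      cmLocalIntegralLevel L 3 (Matrix.of fun i j : Fin 3 => if i.val + j.val + 1 = 3 then (1 : L) else 0) v) :
    ∃ γ₀ : (cmDatum L 3 (Matrix.of fun i j : Fin 3 => if i.val + j.val + 1 = 3 then (1 : L) else 0)).Local v, γ₀ ∈ cmLocalIntegralLevel L 3 (Matrix.of fun i j : Fin 3 => if i.val + j.val + 1 = 3 then (1 : L) else 0) v ∧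
      IsConj (((t : ↥(unitaryGroupOfForm (conjLocal L (IsCMField.complexConj L) v) (cmLocalForm L 3 v))) : GL (Fin 3) (LocalRing L v)))
        (γ₀.val : GL (Fin 3) (LocalRing L v)) ∧
      classOrbitalIntegral mG ((cmLocalIntegralLevel L 3 (Matrix.of fun i j : Fin 3 => if i.val + j.val + 1 = 3 then (1 : L) else 0) v : Set ((cmDatum L 3 (Matrix.of fun i j : Fin 3 => if i.val + j.val + 1 = 3 then (1 : L) else 0)).Local v)).indicator fun _ => (1 : ℂ))
          (ConjClasses.mk γ₀) =
        (((letI : MeasurableSpace (LocalRing L v) := borel _; haveI : BorelSpace (LocalRing L v) := ⟨rfl⟩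
          haveI : SecondCountableTopology (LocalRing L v) := secondCountableTopology_localRing (E := L) v
          ((distribHaarChar (LocalRing L v) ha.unit)⁻¹ *
            (HeisRing.skewModulus (conjLocal L (IsCMField.complexConj L) v) (continuous_conjLocal L (IsCMField.complexConj L) v) hb.unit
              (HeisRing.map_unit_torusCentralScalar_sub_one (conjLocal L (IsCMField.complexConj L) v) (cmLocalForm_eq_over L 3 v) t hd hb))⁻¹ :
                ℝ≥0)) : ℝ) : ℂ) :=
  exists_classOrbitalIntegral_indicator_eq_twist_of_torus_regular_of_formCongr L
    (Matrix.of fun i j : Fin 3 => if i.val + j.val + 1 = 3 then (1 : L) else 0)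
    (antidiagOne_map_transpose (IsCMField.complexConj L) 3) (isUnit_antidiagOne_det L 3) w hw
    ⟨1, one_mem _, by rw [formCongr_one_eq, placeForm_antidiagOne]⟩ νG hmG hνG t hd hreg htreg ha hb htK


end Literature.NumberTheory.Automorphic.UnitaryGroup

end
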